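import Literature.RingTheory.FormalGroups.HondaTypeTransport
import Literature.NumberTheory.EllipticCurves.PadicSeriesEvaluation
import Mathlib.NumberTheory.Basic
import HarnessLib

/-!
# Uniqueness of the Honda type `p − aT + T²` along the Euler recursion, and the logarithmic form
# of the functional-equation estimate (proofs only)

Topic `RingTheory/FormalGroups` (proofs only; no definitions, no named facts). Sequel of
`HondaTypeTransport.lean` (Honda 1970, §2; Hazewinkel 1978, Ch. I §2), whose `hondaShift p a ℓ =
ℓ − (a/p)ℓ(Xᵖ) + (1/p)ℓ(X^{p²})` we use: "`ℓ` is of type `p − aT + T²`" means that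
`hondaShift p a ℓ` has `p`-integral coefficients. Two complements needed to turn Honda's
comparison of the formal group of an elliptic curve with the formal Dirichlet group of a Hecke
eigenform (Honda 1970, §6.2, Thm. 9 and pp. 241–242) into an EQUALITY of `p`-th coefficients
rather than a congruence modulo `p`:

* `eq_of_hondaShift_of_recursion` — **a Dirichlet logarithm has at most one type.** If
  `ℓ = Σ_{n≥1} aₙXⁿ/n` with `aₙ ∈ ℤ_p`, `a₁ = 1` and `a_{p^{k+2}} = a_p a_{p^{k+1}} − p a_{pᵏ}`
  (the Euler factor `(1 − a_pT + pT²)⁻¹` at `p`) is of type `p − bT + T²` and of type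
  `p − b'T + T²`, then `b = b'`. Proof: `hondaShift p b ℓ − hondaShift p b' ℓ =
  ((b' − b)/p)·ℓ(Xᵖ)` is integral, so `‖(b' − b)·a_{pᵏ}‖ ≤ p^{−k−1}` for all `k`
  (coefficient of `X^{p^{k+1}}`), while along the recursion `‖a_{p^{2j}}‖ ≥ p^{−j}`
  (`norm_seq_two_mul_ge`: all `a_{pᵏ}` are units if `‖a_p‖ = 1`; `‖a_{p^{2j}}‖ = p^{−j}` exactly
  if `‖a_p‖ < 1`), whence `‖b' − b‖ ≤ p^{−j−1}` for every `j`. (Honda's types are unique only up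
  to a unit of `ℤ_p⟦T⟧`, Honda 1970, Thm. 2 and Prop. 2.6, so that in general a type determines
  `a` modulo `p` only — `HondaTypeTransport.dvd_sub_of_hondaShift`; for a NORMALISED quadratic
  type of a series obeying the Euler recursion the middle coefficient is pinned down.)
* `norm_coeff_subst_sub_subst_le_of_natCast_mul_coeff_le` — **`ℓ(u) ≡ ℓ(v) (mod p)` whenever
  `u ≡ v (mod p)`**, for ANY `ℓ ∈ ℚ_p⟦X⟧` with `n·[Xⁿ]ℓ ∈ ℤ_p` (e.g. the logarithm
  `Σ c_{n−1}Xⁿ/n` of a formal group over `ℤ_p`, with no hypothesis on its type) and integral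
  `u, v` without constant term: `ℓ(u) − ℓ(v) = Σₘ [Xᵐ]ℓ·(uᵐ − vᵐ)` and `uᵐ − vᵐ ∈ mpℤ_p⟦X⟧`
  (`natCast_mul_dvd_pow_sub_pow`, from Mathlib's `dvd_sub_pow_of_dvd_sub`). This is the
  estimate by which an identity `[p](X) −_F [a](Xᵖ) +_F X^{p²} ≡ 0 (mod p)` in a formal group
  over `ℤ_p` becomes the type statement `p·log − a·log(Xᵖ) + log(X^{p²}) ≡ 0 (mod p)` for its
  logarithm (Honda 1970, proof of Thm. 2 / Lemma 4.2; Hazewinkel 1978, I.2.2 (iv) needs the type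
  of `ℓ` as INPUT and cannot be used there).

## Sources

* T. Honda, *On the theory of commutative formal groups*, J. Math. Soc. Japan 22 (1970),
  213–246: §2 (types; Lemmas 2.1–2.4, Thm. 2, Prop. 2.6), §6 (Thm. 8, Thm. 9, pp. 239–242).
  [Honda1970]
* M. Hazewinkel, *Formal Groups and Applications*, Academic Press 1978, Ch. I §2.1–2.3 (the
  functional equation lemma). [Hazewinkel1978]
* T. Honda, *Formal groups and zeta-functions*, Osaka J. Math. 5 (1968), 199–213 (elliptic
  curves over `ℚ`; the recursion `a_{p^{k+2}} = a_p a_{p^{k+1}} − p a_{pᵏ}` of `L(E, s)`).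

## Design notes

Pure proof file over `ℚ_p`; the divisibility `mp ∣ uᵐ − vᵐ` is proved in `ℤ_p⟦X⟧` and moved to
`ℚ_p⟦X⟧` coefficientwise through the tree's `IsPadicInt` / `PadicSeriesEvaluation` dictionary.
Nothing is defined, nothing is asserted.
-/

noncomputable section

open PowerSeries Literature.NumberTheory.EllipticCurves

namespace Literature.RingTheory.FormalGroups

variable {p : ℕ} [hp : Fact p.Prime]

/-! ### `mp ∣ uᵐ − vᵐ` when `p ∣ u − v`, over rings in which the integers prime to `p` are units -/

omit hp in
/-- **`u ≡ v (mod p)` implies `uᵐ ≡ vᵐ (mod mp)`** in a commutative ring in which every natural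
number prime to `p` is a unit (e.g. a `ℤ_(p)`-algebra): with `m = pᵏr`, `p ∤ r`, Mathlib's
`dvd_sub_pow_of_dvd_sub` gives `pᵏ⁺¹ ∣ u^{pᵏ} − v^{pᵏ}`, which divides `uᵐ − vᵐ`, and `r` is a
unit. (Hazewinkel 1978, I.2.3, proof of the functional equation lemma:
"`y ≡ z mod 𝔞ʳ ⇒ y^{pⁱ} ≡ z^{pⁱ} mod 𝔞^{r+i}`".) [folklore] -/
theorem natCast_mul_dvd_pow_sub_pow {R : Type*} [CommRing R] (hp1 : p ≠ 1)
    (hunit : ∀ r : ℕ, ¬ p ∣ r → IsUnit (r : R)) {u v : R} (h : (p : R) ∣ u - v) (m : ℕ) :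
    ((m : R) * p) ∣ u ^ m - v ^ m := by
  rcases eq_or_ne m 0 with rfl | hm
  · simp
  obtain ⟨k, r, hr, rfl⟩ := Nat.exists_eq_pow_mul_and_not_dvd hm p hp1
  have h1 : (p : R) ^ (k + 1) ∣ u ^ p ^ k - v ^ p ^ k := dvd_sub_pow_of_dvd_sub h k
  have h2 : u ^ p ^ k - v ^ p ^ k ∣ (u ^ p ^ k) ^ r - (v ^ p ^ k) ^ r := sub_dvd_pow_sub_pow _ _ r
  rw [pow_mul, pow_mul]
  have h3 : ((p ^ k * r : ℕ) : R) * p = (p : R) ^ (k + 1) * r := by push_cast; ring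
  rw [h3]
  exact (IsUnit.mul_right_dvd (hunit r hr)).mpr (h1.trans h2)

/-- In `ℤ_p⟦X⟧` every natural number prime to `p` is a unit. [folklore] -/
theorem isUnit_natCast_padicIntPowerSeries {r : ℕ} (hr : ¬ p ∣ r) : IsUnit (r : ℤ_[p]⟦X⟧) := by
  have h : IsUnit (r : ℤ_[p]) := by
    rw [PadicInt.isUnit_iff, PadicInt.norm_natCast_eq_one_iff]
    exact (Nat.Prime.coprime_iff_not_dvd hp.out).mpr hr
  simpa using h.map (C : ℤ_[p] →+* ℤ_[p]⟦X⟧)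

/-- `mp ∣ uᵐ − vᵐ` in `ℤ_p⟦X⟧` when `p ∣ u − v`. [folklore] -/
theorem natCast_mul_dvd_pow_sub_pow_padicInt {u v : ℤ_[p]⟦X⟧} (h : (p : ℤ_[p]⟦X⟧) ∣ u - v)
    (m : ℕ) : ((m : ℤ_[p]⟦X⟧) * p) ∣ u ^ m - v ^ m :=
  natCast_mul_dvd_pow_sub_pow hp.out.ne_one (fun _ hr => isUnit_natCast_padicIntPowerSeries hr) h m

/-! ### Coefficientwise translation between divisibility in `ℤ_p⟦X⟧` and norms in `ℚ_p⟦X⟧` -/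

/-- `‖x‖ ≤ p⁻¹` iff `p ∣ x` in `ℤ_p`. [folklore] -/
theorem padicInt_norm_le_inv_iff_dvd (x : ℤ_[p]) : ‖x‖ ≤ (p : ℝ)⁻¹ ↔ (p : ℤ_[p]) ∣ x := by
  rw [← PadicInt.norm_lt_one_iff_dvd, ← zpow_neg_one, PadicInt.norm_le_pow_iff_norm_lt_pow_add_one]
  norm_num

/-- A series in `ℤ_p⟦X⟧` all of whose coefficients are divisible by `p` is divisible by `p`.
[folklore] -/
theorem C_natCast_dvd_of_forall_dvd_coeff {G : ℤ_[p]⟦X⟧} (h : ∀ n, (p : ℤ_[p]) ∣ coeff n G) :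
    (p : ℤ_[p]⟦X⟧) ∣ G := by
  choose c hc using h
  refine ⟨PowerSeries.mk c, ?_⟩
  ext n
  rw [show (p : ℤ_[p]⟦X⟧) = C (p : ℤ_[p]) from (map_natCast C p).symm, coeff_C_mul, coeff_mk]
  exact hc n

/-- Coefficients of a multiple of `c` in `ℤ_p⟦X⟧` have norm at most `‖c‖` in `ℚ_p`. [folklore] -/
theorem norm_coeff_map_le_of_dvd {c : ℤ_[p]} {G : ℤ_[p]⟦X⟧} (h : (C c : ℤ_[p]⟦X⟧) ∣ G) (n : ℕ) :
    ‖coeff n (G.map PadicInt.Coe.ringHom)‖ ≤ ‖(c : ℚ_[p])‖ := by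
  obtain ⟨H, rfl⟩ := h
  rw [coeff_map_coe, coeff_C_mul, PadicInt.coe_mul, norm_mul]
  exact mul_le_of_le_one_right (norm_nonneg _) (PadicInt.norm_le_one _)

/-- An integral series whose coefficients have norm `≤ p⁻¹` is `p` times an integral series of
`ℤ_p⟦X⟧`. [folklore] -/
theorem exists_eq_natCast_mul_map_of_norm_coeff_le {f : ℚ_[p]⟦X⟧}
    (h : ∀ n, ‖coeff n f‖ ≤ (p : ℝ)⁻¹) :
    ∃ G : ℤ_[p]⟦X⟧, f = (p : ℚ_[p]⟦X⟧) * G.map PadicInt.Coe.ringHom := by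
  have hint : IsPadicInt f := isPadicInt_iff_coeff.mpr fun n =>
    (h n).trans (inv_le_one_of_one_le₀ (by exact_mod_cast hp.out.one_le))
  obtain ⟨F, hF⟩ := isPadicInt_iff_exists_powerSeries_map.mp hint
  have hdvd : ∀ n, (p : ℤ_[p]) ∣ coeff n F := fun n => by
    rw [← padicInt_norm_le_inv_iff_dvd]
    have := h n
    rwa [← hF, coeff_map_coe, ← PadicInt.norm_def] at this
  obtain ⟨G, hG⟩ := C_natCast_dvd_of_forall_dvd_coeff hdvd
  refine ⟨G, ?_⟩
  rw [← hF, hG, map_mul, map_natCast]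

/-- The lift to `ℤ_p⟦X⟧` of a congruence `u ≡ v (mod p)` between integral series. [folklore] -/
theorem C_natCast_dvd_sub_of_norm_coeff_sub_le {U V : ℤ_[p]⟦X⟧}
    (huv : ∀ n, ‖coeff n (U.map PadicInt.Coe.ringHom - V.map PadicInt.Coe.ringHom)‖ ≤ (p : ℝ)⁻¹) :
    (p : ℤ_[p]⟦X⟧) ∣ U - V := by
  apply C_natCast_dvd_of_forall_dvd_coeff
  intro k
  rw [← padicInt_norm_le_inv_iff_dvd, PadicInt.norm_def, map_sub, PadicInt.coe_sub]
  have := huv k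
  rwa [← map_sub, coeff_map_coe, map_sub, PadicInt.coe_sub] at this

/-! ### `ℓ(u) ≡ ℓ(v) (mod p)` for `ℓ` with `n·[Xⁿ]ℓ ∈ ℤ_p` -/

/-- **The functional-equation estimate for a logarithm, without a type.** Let `ℓ ∈ ℚ_p⟦X⟧`
have `n·[Xⁿ]ℓ ∈ ℤ_p` for all `n` (e.g. `ℓ = Σ cₙ₋₁Xⁿ/n`, the logarithm of a formal group over
`ℤ_p`), and let `u, v ∈ Xℤ_p⟦X⟧` with `u ≡ v (mod p)`. Then `ℓ(u) ≡ ℓ(v) (mod p)`: indeed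
`ℓ(u) − ℓ(v) = Σₘ [Xᵐ]ℓ · (uᵐ − vᵐ)` and `uᵐ − vᵐ ∈ mpℤ_p⟦X⟧`, so the denominator `m` of `[Xᵐ]ℓ` is
absorbed (Honda 1970, proof of Lemma 2.3 and of Thm. 2, p. 222–223; Hazewinkel 1978, I.2.3 —
the part of the proof of (iv) that does not use the functional equation). [folklore] -/
theorem norm_coeff_subst_sub_subst_le_of_natCast_mul_coeff_le {ℓ u v : ℚ_[p]⟦X⟧}
    (hℓ : ∀ n : ℕ, ‖(n : ℚ_[p]) * coeff n ℓ‖ ≤ 1)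
    (hu0 : constantCoeff u = 0) (hu : ∀ n, ‖coeff n u‖ ≤ 1)
    (hv0 : constantCoeff v = 0) (hv : ∀ n, ‖coeff n v‖ ≤ 1)
    (huv : ∀ n, ‖coeff n (u - v)‖ ≤ (p : ℝ)⁻¹) (n : ℕ) :
    ‖coeff n (ℓ.subst u - ℓ.subst v)‖ ≤ (p : ℝ)⁻¹ := by
  -- lift `u, v` to `ℤ_p⟦X⟧` and get `p ∣ U − V`
  obtain ⟨U, rfl⟩ := isPadicInt_iff_exists_powerSeries_map.mp (isPadicInt_iff_coeff.mpr hu)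
  obtain ⟨V, rfl⟩ := isPadicInt_iff_exists_powerSeries_map.mp (isPadicInt_iff_coeff.mpr hv)
  have hUV : (p : ℤ_[p]⟦X⟧) ∣ U - V := C_natCast_dvd_sub_of_norm_coeff_sub_le huv
  -- coefficientwise
  rw [map_sub, coeff_subst_eq_sum hu0, coeff_subst_eq_sum hv0, ← Finset.sum_sub_distrib]
  refine IsUltrametricDist.norm_sum_le_of_forall_le_of_nonneg (inv_nonneg.mpr (Nat.cast_nonneg p))
    fun m _ => ?_
  rw [← mul_sub, ← map_pow, ← map_pow, ← map_sub, ← map_sub]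
  -- `uᵐ − vᵐ = mp · w`
  obtain ⟨w, hw⟩ := natCast_mul_dvd_pow_sub_pow_padicInt hUV m
  rw [hw, show ((m : ℤ_[p]⟦X⟧) * p) = C ((m : ℤ_[p]) * (p : ℤ_[p])) by simp, map_mul, map_C,
    coeff_C_mul, ← mul_assoc, norm_mul]
  have h1 : ‖coeff m ℓ * PadicInt.Coe.ringHom ((m : ℤ_[p]) * (p : ℤ_[p]))‖ ≤ (p : ℝ)⁻¹ := by
    rw [map_mul, map_natCast, map_natCast, ← mul_assoc, norm_mul, mul_comm (coeff m ℓ), Padic.norm_p]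
    exact mul_le_of_le_one_left (inv_nonneg.mpr (Nat.cast_nonneg p)) (hℓ m)
  have h2 : ‖coeff n (map PadicInt.Coe.ringHom w)‖ ≤ 1 := by
    rw [coeff_map_coe]; exact PadicInt.norm_le_one _
  calc _ ≤ (p : ℝ)⁻¹ * 1 := mul_le_mul h1 h2 (norm_nonneg _) (inv_nonneg.mpr (Nat.cast_nonneg p))
    _ = (p : ℝ)⁻¹ := mul_one _

/-- Special case `v = 0`: if `u ∈ pXℤ_p⟦X⟧` then `ℓ(u) ≡ ℓ(0)·1 = [X⁰]ℓ (mod p)`; for `ℓ(0) = 0`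
simply `ℓ(u) ≡ 0 (mod p)`. [folklore] -/
theorem norm_coeff_subst_le_of_natCast_mul_coeff_le {ℓ u : ℚ_[p]⟦X⟧} (hℓ0 : constantCoeff ℓ = 0)
    (hℓ : ∀ n : ℕ, ‖(n : ℚ_[p]) * coeff n ℓ‖ ≤ 1) (hu0 : constantCoeff u = 0)
    (hu : ∀ n, ‖coeff n u‖ ≤ (p : ℝ)⁻¹) (n : ℕ) :
    ‖coeff n (ℓ.subst u)‖ ≤ (p : ℝ)⁻¹ := by
  have hpinv1 : (p : ℝ)⁻¹ ≤ 1 := inv_le_one_of_one_le₀ (by exact_mod_cast hp.out.one_le)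
  have h := norm_coeff_subst_sub_subst_le_of_natCast_mul_coeff_le hℓ hu0
    (fun k => (hu k).trans hpinv1) (map_zero _) (fun k => by rw [map_zero, norm_zero]; exact zero_le_one)
    (fun k => by rw [sub_zero]; exact hu k) n
  rwa [subst_zero_of_constantCoeff_zero hℓ0, sub_zero] at h

/-! ### A Dirichlet logarithm `Σ aₙXⁿ/n` with Euler recursion at `p` has at most one type -/

/-- **Valuations along the recursion `u_{k+2} = u₁u_{k+1} − pu_k`, `u₀ = 1`** (the sequence
`u_k = a_{pᵏ}` of Hecke eigenvalues, or of traces of Frobenius): for integral `u_k`,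
`‖u_{2j}‖ ≥ p^{−j}`. In the ordinary case `‖u₁‖ = 1` all `u_k` are units; in the supersingular
case `‖u₁‖ < 1` one has `‖u_{2j}‖ = p^{−j}` exactly and `‖u_{2j+1}‖ ≤ p^{−j−1}` (ultrametric
bookkeeping). [folklore] -/
theorem norm_seq_two_mul_ge {u : ℕ → ℚ_[p]} (h0 : u 0 = 1) (hint : ∀ k, ‖u k‖ ≤ 1)
    (hrec : ∀ k, u (k + 2) = u 1 * u (k + 1) - p * u k) (j : ℕ) :
    (p : ℝ)⁻¹ ^ j ≤ ‖u (2 * j)‖ := by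
  have hp1 : (1 : ℝ) < p := by exact_mod_cast hp.out.one_lt
  have hpinv : (0 : ℝ) < (p : ℝ)⁻¹ := inv_pos.mpr (zero_lt_one.trans hp1)
  have hpinv1 : (p : ℝ)⁻¹ < 1 := inv_lt_one_of_one_lt₀ hp1
  have hnp : ‖(p : ℚ_[p])‖ = (p : ℝ)⁻¹ := Padic.norm_p
  rcases (hint 1).lt_or_eq with h1 | h1
  · -- supersingular
    have h1' : ‖u 1‖ ≤ (p : ℝ)⁻¹ := by
      rw [← zpow_neg_one, Padic.norm_le_pow_iff_norm_lt_pow_add_one]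
      norm_num; exact h1
    suffices H : ∀ j, ‖u (2 * j)‖ = (p : ℝ)⁻¹ ^ j ∧ ‖u (2 * j + 1)‖ ≤ (p : ℝ)⁻¹ ^ (j + 1) from
      (H j).1.ge
    intro j
    induction j with
    | zero =>
      refine ⟨by rw [mul_zero, h0, norm_one, pow_zero], ?_⟩
      simpa using h1'
    | succ j ih =>
      have e2 : u (2 * (j + 1)) = u 1 * u (2 * j + 1) - p * u (2 * j) := by
        rw [show 2 * (j + 1) = 2 * j + 2 by ring]; exact hrec (2 * j)
      have e3 : u (2 * (j + 1) + 1) = u 1 * u (2 * (j + 1)) - p * u (2 * j + 1) := by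
        rw [show 2 * (j + 1) + 1 = (2 * j + 1) + 2 by ring, show 2 * (j + 1) = (2 * j + 1) + 1 by ring]
        exact hrec (2 * j + 1)
      have nB : ‖(p : ℚ_[p]) * u (2 * j)‖ = (p : ℝ)⁻¹ ^ (j + 1) := by
        rw [norm_mul, hnp, ih.1, pow_succ']
      have nA : ‖u 1 * u (2 * j + 1)‖ < ‖(p : ℚ_[p]) * u (2 * j)‖ := by
        rw [nB, norm_mul]
        calc ‖u 1‖ * ‖u (2 * j + 1)‖ ≤ (p : ℝ)⁻¹ * (p : ℝ)⁻¹ ^ (j + 1) :=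
              mul_le_mul h1' ih.2 (norm_nonneg _) hpinv.le
          _ = (p : ℝ)⁻¹ ^ (j + 1) * (p : ℝ)⁻¹ := mul_comm _ _
          _ < (p : ℝ)⁻¹ ^ (j + 1) * 1 := by gcongr
          _ = (p : ℝ)⁻¹ ^ (j + 1) := mul_one _
      have first : ‖u (2 * (j + 1))‖ = (p : ℝ)⁻¹ ^ (j + 1) := by
        rw [e2, ← nB, ← norm_neg ((p : ℚ_[p]) * u (2 * j))]
        apply Padic.norm_eq_of_norm_sub_lt_right
        rw [sub_neg_eq_add, sub_add_cancel, norm_neg]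
        exact nA
      refine ⟨first, ?_⟩
      rw [e3, sub_eq_add_neg]
      refine (Padic.nonarchimedean _ _).trans (max_le ?_ ?_)
      · rw [norm_mul, first, pow_succ' _ (j + 1)]
        exact mul_le_mul_of_nonneg_right h1' (pow_nonneg hpinv.le _)
      · rw [norm_neg, norm_mul, hnp, pow_succ' _ (j + 1)]
        exact mul_le_mul_of_nonneg_left ih.2 hpinv.le
  · -- ordinary: all `u_k` are units
    suffices H : ∀ k, ‖u k‖ = 1 ∧ ‖u (k + 1)‖ = 1 by
      rw [(H (2 * j)).1]; exact pow_le_one₀ hpinv.le hpinv1.le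
    intro k
    induction k with
    | zero => exact ⟨by rw [h0, norm_one], by rw [zero_add, h1]⟩
    | succ k ih =>
      refine ⟨ih.2, ?_⟩
      rw [show k + 1 + 1 = k + 2 by ring, hrec k]
      have nA : ‖u 1 * u (k + 1)‖ = 1 := by rw [norm_mul, h1, ih.2, one_mul]
      have nB : ‖(p : ℚ_[p]) * u k‖ < ‖u 1 * u (k + 1)‖ := by
        rw [nA, norm_mul, hnp, ih.1, mul_one]; exact hpinv1
      rw [← nA]
      apply Padic.norm_eq_of_norm_sub_lt_right
      rwa [sub_sub_cancel_left, norm_neg]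

/-- If `‖c · u_k‖ ≤ p^{−k−1}` for all `k` along such a recursion, then `c = 0`
(`‖c‖ ≤ p^{−j−1}` for every `j`, by `norm_seq_two_mul_ge`). [folklore] -/
theorem eq_zero_of_norm_mul_seq_le {u : ℕ → ℚ_[p]} (h0 : u 0 = 1) (hint : ∀ k, ‖u k‖ ≤ 1)
    (hrec : ∀ k, u (k + 2) = u 1 * u (k + 1) - p * u k) {c : ℚ_[p]}
    (hc : ∀ k, ‖c * u k‖ ≤ (p : ℝ)⁻¹ ^ (k + 1)) : c = 0 := by
  have hp1 : (1 : ℝ) < p := by exact_mod_cast hp.out.one_lt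
  have hpinv : (0 : ℝ) < (p : ℝ)⁻¹ := inv_pos.mpr (zero_lt_one.trans hp1)
  have hpinv1 : (p : ℝ)⁻¹ < 1 := inv_lt_one_of_one_lt₀ hp1
  have hbound : ∀ j, ‖c‖ ≤ (p : ℝ)⁻¹ ^ (j + 1) := fun j => by
    have h1 := hc (2 * j)
    have h2 := norm_seq_two_mul_ge h0 hint hrec j
    rw [norm_mul] at h1
    have h4 : ‖c‖ * (p : ℝ)⁻¹ ^ j ≤ (p : ℝ)⁻¹ ^ (2 * j + 1) :=
      (mul_le_mul_of_nonneg_left h2 (norm_nonneg c)).trans h1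
    have h5 : (p : ℝ)⁻¹ ^ (2 * j + 1) = (p : ℝ)⁻¹ ^ (j + 1) * (p : ℝ)⁻¹ ^ j := by
      rw [← pow_add]; congr 1; ring
    rw [h5] at h4
    exact le_of_mul_le_mul_right h4 (pow_pos hpinv j)
  by_contra hc0
  obtain ⟨j, hj⟩ := exists_pow_lt_of_lt_one (norm_pos_iff.mpr hc0) hpinv1
  have := (hbound j).trans (pow_le_pow_of_le_one hpinv.le hpinv1.le (Nat.le_succ j))
  exact absurd (hj.trans_le this) (lt_irrefl _)

/-- **A Dirichlet logarithm has at most one quadratic type.** Let `ℓ = Σ_{n ≥ 1} aₙXⁿ/n ∈ ℚ_p⟦X⟧`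
(Mathlib `PowerSeries.mk fun k ↦ a k / k`, as in `norm_coeff_hondaShift_mk_div_le_one`) with
`aₙ ∈ ℤ_p`, `a₁ = 1` and the Euler recursion `a_{p^{k+2}} = a_p a_{p^{k+1}} − p a_{pᵏ}` at `p` —
the formal Dirichlet series of a normalised Hecke eigenform (Honda 1970, §6.1, Thm. 8), or the
logarithm attached to `L(E, s)` of an elliptic curve (Honda 1970, Thm. 9; Honda 1968). If `ℓ` is
of type `p − bT + T²` and of type `p − b'T + T²` (`hondaShift p b ℓ`, `hondaShift p b' ℓ` both
`p`-integral), then `b = b'`: subtracting, `((b' − b)/p)·ℓ(Xᵖ) ∈ ℤ_p⟦X⟧`, whose coefficient of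
`X^{p^{k+1}}` is `(b' − b)·a_{pᵏ}/p^{k+1}`, and `eq_zero_of_norm_mul_seq_le` applies.
(For Honda a type is unique up to a unit of `ℤ_p⟦T⟧` only, Honda 1970, Thm. 2; the recursion is
what singles out the normalised representative.) [folklore] -/
theorem eq_of_hondaShift_of_recursion {a : ℕ → ℚ_[p]} (ha1 : a 1 = 1) (hint : ∀ n, ‖a n‖ ≤ 1)
    (hrec : ∀ k, a (p ^ (k + 2)) = a p * a (p ^ (k + 1)) - p * a (p ^ k)) {b b' : ℚ_[p]}
    (hb : ∀ n, ‖coeff n (hondaShift p b (PowerSeries.mk fun k ↦ a k / k))‖ ≤ 1)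
    (hb' : ∀ n, ‖coeff n (hondaShift p b' (PowerSeries.mk fun k ↦ a k / k))‖ ≤ 1) : b = b' := by
  have hp0 : (p : ℚ_[p]) ≠ 0 := by exact_mod_cast hp.out.ne_zero
  have hp1 : (1 : ℝ) < p := by exact_mod_cast hp.out.one_lt
  have hppos : (0 : ℝ) < p := zero_lt_one.trans hp1
  set ℓ : ℚ_[p]⟦X⟧ := PowerSeries.mk fun k ↦ a k / k with hℓ
  -- `((b' − b)/p) ℓ(Xᵖ) ∈ ℤ_p⟦X⟧`
  have hdiff : ∀ n, ‖coeff n (C ((b' - b) / p) * expand p (prime_ne_zero p) ℓ)‖ ≤ 1 := fun n => by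
    have e : C ((b' - b) / p) * expand p (prime_ne_zero p) ℓ =
        hondaShift p b ℓ - hondaShift p b' ℓ := by
      rw [hondaShift_def, hondaShift_def, sub_div, map_sub]; ring
    rw [e]
    exact norm_coeff_sub_le hb hb' n
  -- read off the coefficient of `X^{p^{k+1}}`
  have hc : ∀ k, ‖(b' - b) * a (p ^ k)‖ ≤ (p : ℝ)⁻¹ ^ (k + 1) := fun k => by
    have h := hdiff (p ^ (k + 1))
    rw [coeff_C_mul, pow_succ', coeff_expand_mul, hℓ, coeff_mk, Nat.cast_pow,
      show (b' - b) / (p : ℚ_[p]) * (a (p ^ k) / (p : ℚ_[p]) ^ k) =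
        (b' - b) * a (p ^ k) / (p : ℚ_[p]) ^ (k + 1) by rw [pow_succ]; field_simp,
      norm_div, norm_pow, Padic.norm_p, div_le_iff₀ (pow_pos (inv_pos.mpr hppos) (k + 1)),
      one_mul] at h
    exact h
  have hzero := eq_zero_of_norm_mul_seq_le (u := fun k => a (p ^ k)) (by simp [ha1])
    (fun k => hint _) (fun k => by simpa using hrec k) hc
  exact (sub_eq_zero.mp hzero).symm

end Literature.RingTheory.FormalGroups
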